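import Literature.Geometry.Lorentzian.InverseMeanCurvatureFlowCalibration
import Literature.Geometry.Lorentzian.InverseMeanCurvatureFlowConstancy
import HarnessLib

/-!
# Inverse mean curvature flow I — proofs: Huisken–Ilmanen's Uniqueness Theorem 2.2 and uniqueness in Thm. 3.1

Sorry-free continuation of `InverseMeanCurvatureFlowCalibration.lean` and
`InverseMeanCurvatureFlowConstancy.lean`: the Uniqueness Theorem 2.2 (i) of Huisken–Ilmanen
(J. Differential Geom. 59 (2001)) for the weak formulation (1.5) of `InverseMeanCurvatureFlow.lean`
on a connected, noncompact Riemannian `3`-manifold ("`M` has no compact component; `M` need not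
be complete"). Everything is proved; no definitions, no named facts.

* `IsWeakSupersolution.strict_const_mul` — for a weak supersolution `u ≥ 0` and `c ≥ 1`, `c u`
  satisfies the strict inequality (2.2) with `ε = 1 - c⁻¹` ("`u_ε := u/(1-ε)` satisfies (2.2)").
* `eq_empty_of_ae_gradNorm_eq_zero` — the topological end of the proof: if `|∇U| = |∇v| = 0` a.e.
  on `W = {v > U} ∩ Ω ⊂⊂ Ω`, then `W = ∅` (both functions are constant on each component of the
  open set `W`; a component is open and, `X` being connected and noncompact, not closed; at a
  boundary point continuity gives `v > U` again).
* `IsWeakSupersolution.le_of_isWeakSubsolution_of_nonneg`, `IsWeakSupersolution.le_of_isWeakSubsolution`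
  — **Thm. 2.2 (i)**: if `u` is a weak supersolution and `v` a weak subsolution on the open set
  `Ω` with `{v > u} ∩ Ω ⊂⊂ Ω`, then `v ≤ u` on `Ω` (first for `u ≥ 0` via `c u`, `c ↓ 1`, and a
  downward shift of `v` arranging `sup(v - cu) ≤ ε`; in general after shrinking `Ω` to a
  precompact neighbourhood of the compact set and adding a constant to `u` and `v`).

* `IsWeakSolutionIVP.setOf_lt_subset_setOf_lt` — **Thm. 2.2 (ii)**: `E₀ ⊆ F₀` and `E_t` precompact imply
  `E_t ⊆ F_t` (`min(w, t)` is a subsolution on `M ∖ F̄₀` by (1.18); compare with `u + δ` on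
  `W = E_t ∖ F̄₀` by Thm. 2.2 (i), using the Dirichlet conditions on `∂E_t` and `∂F₀`);
  `IsWeakSolutionIVP.setOf_lt_eq_setOf_lt`, `IsWeakSolutionIVP.eq_of_isProperFun` — **Thm. 2.2 (iii)**
  for proper solutions, and equality off `E₀`.
* `weak_uniqueness` — **the uniqueness clause of the Weak Existence Theorem 3.1** in the exact
  binder form of the named fact `weak_existence` (`InverseMeanCurvatureFlow.lean`): on a connected
  noncompact `3`-manifold, proper solutions of (††) with a given precompact initial condition `E₀`
  are unique on `X ∖ E₀` (no completeness or subsolution-at-infinity hypothesis is needed for this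
  half). The existence clause (elliptic regularisation, §3 of the source) remains a named fact.

## References

* G. Huisken, T. Ilmanen, *The inverse mean curvature flow and the Riemannian Penrose
  inequality*, J. Differential Geom. 59 (2001) 353–437: Thm. 2.2 (i)–(iii) and their proofs;
  Thm. 3.1 (uniqueness clause) and the last paragraph of its proof.
-/

noncomputable section

open Bundle Set Manifold TopologicalSpace Filter MeasureTheory Function
open scoped ContDiff Topology ENNReal NNReal Manifold Real

namespace Literature.Geometry.Lorentzian

open PseudoRiemannianMetric

variable {X : Type*} [TopologicalSpace X] [ChartedSpace E3 X] [IsManifold (𝓡 3) ∞ X]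

/-! ### Scaling a nonnegative supersolution makes it strict -/

section Strict

variable (h : ContMDiffRiemannianMetric (𝓡 3) ∞ E3 (TangentSpace (𝓡 3) : X → Type _))
  [T2Space X] [LocallyCompactSpace X] [MeasurableSpace X] [BorelSpace X]
  [SecondCountableTopology X]

/-- **`u/(1 - ε)` satisfies (2.2).** If `u ≥ 0` is a weak supersolution of (∗∗) on the open set `Ω`
and `c ≥ 1`, then `U = c u` is a *strict* supersolution with `ε = 1 - c⁻¹`:
`J_U^K(U) + ε ∫_K (w - U)|∇U| ≤ J_U^K(w)` for every competitor `w ≥ U` — insert `w/c ≥ u` into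
(1.5) for `u` and multiply by `c` (`|∇(c u)| = c |∇u|`). Huisken–Ilmanen 2001, proof of Thm. 2.2
(i), last paragraph ("`u_ε := u/(1-ε)` satisfies (2.2)"). [cite: HuiskenIlmanenIMCF2001, proof of Thm. 2.2 (i)] -/
theorem IsWeakSupersolution.strict_const_mul {u : X → ℝ} {Ω : Set X}
    (hu : IsWeakSupersolution h u Ω) (hΩ : IsOpen Ω) {c : ℝ} (hc : 1 ≤ c) :
    ∀ w, IsCompetitor h (fun x ↦ c * u x) Ω w → (∀ x ∈ Ω, c * u x ≤ w x) →
      ∀ K, IsCompact K → K ⊆ Ω → {x | x ∈ Ω ∧ w x ≠ c * u x} ⊆ K →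
        imcfEnergy h (fun x ↦ c * u x) K (fun x ↦ c * u x) +
          (1 - c⁻¹) * ∫ x in K, (w x - c * u x) * gradNorm h (fun x ↦ c * u x) x
            ∂riemannianMeasure h ≤
        imcfEnergy h (fun x ↦ c * u x) K w := by
  intro w hw hle K hK hKΩ hwK
  have hc0 : 0 < c := by linarith
  have hul := hu.1
  have hUl : IsLocLipschitzOn h (fun x ↦ c * u x) Ω := hul.const_mul h c
  obtain ⟨hwl, C, hC, hCΩ, hwC⟩ := hw
  -- the competitor `w/c ≥ u` for `u`
  have hw'l : IsLocLipschitzOn h (fun x ↦ c⁻¹ * w x) Ω := hwl.const_mul h c⁻¹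
  have hne : ∀ x, c⁻¹ * w x ≠ u x → w x ≠ c * u x := by
    intro x h1 h2; apply h1; rw [h2, ← mul_assoc, inv_mul_cancel₀ hc0.ne', one_mul]
  have hw' : IsCompetitor h u Ω (fun x ↦ c⁻¹ * w x) :=
    ⟨hw'l, C, hC, hCΩ, fun x hx ↦ hwC ⟨hx.1, hne x hx.2⟩⟩
  have hle' : ∀ x ∈ Ω, u x ≤ c⁻¹ * w x := fun x hx ↦ by
    rw [le_inv_mul_iff₀ hc0]; exact hle x hx
  have hwK' : {x | x ∈ Ω ∧ c⁻¹ * w x ≠ u x} ⊆ K := fun x hx ↦ hwK ⟨hx.1, hne x hx.2⟩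
  have key := hu.2 _ hw' hle' K hK hKΩ hwK'
  -- integrability
  have iIU := integrableOn_imcfEnergy_integrand h hUl hUl hΩ hK hKΩ
  have iIw := integrableOn_imcfEnergy_integrand h hUl hwl hΩ hK hKΩ
  have iIu := integrableOn_imcfEnergy_integrand h hul hul hΩ hK hKΩ
  have iIw' := integrableOn_imcfEnergy_integrand h hul hw'l hΩ hK hKΩ
  have iex : IntegrableOn (fun x ↦ (w x - c * u x) * gradNorm h (fun x ↦ c * u x) x) K
      (riemannianMeasure h) :=
    (hUl.integrableOn_gradNorm h hΩ hK hKΩ).continuousOn_mul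
      (((hwl.sub h hUl).continuousOn h).mono hKΩ) hK
  -- everything in terms of `|∇u|`: the target difference is `c` times the difference for `u`
  unfold imcfEnergy at key ⊢
  rw [← integral_const_mul]
  have hdiff : ∫ x in K, (gradNorm h w x + w x * gradNorm h (fun x ↦ c * u x) x) ∂riemannianMeasure h -
      (∫ x in K, (gradNorm h (fun x ↦ c * u x) x + c * u x * gradNorm h (fun x ↦ c * u x) x)
        ∂riemannianMeasure h +
        ∫ x in K, (1 - c⁻¹) * ((w x - c * u x) * gradNorm h (fun x ↦ c * u x) x)
          ∂riemannianMeasure h) =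
      c * (∫ x in K, (gradNorm h (fun x ↦ c⁻¹ * w x) x + c⁻¹ * w x * gradNorm h u x)
        ∂riemannianMeasure h -
        ∫ x in K, (gradNorm h u x + u x * gradNorm h u x) ∂riemannianMeasure h) := by
    have i5 : IntegrableOn (fun x ↦ gradNorm h (fun x ↦ c * u x) x + c * u x * gradNorm h (fun x ↦ c * u x) x +
        (1 - c⁻¹) * ((w x - c * u x) * gradNorm h (fun x ↦ c * u x) x)) K (riemannianMeasure h) :=
      iIU.add (iex.const_mul _)
    rw [← integral_add iIU (iex.const_mul _), ← integral_sub iIw i5, ← integral_sub iIw' iIu,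
      ← integral_const_mul]
    refine integral_congr_ae (Eventually.of_forall fun x ↦ ?_)
    simp only [gradNorm_const_mul, abs_of_pos hc0, abs_of_pos (inv_pos.2 hc0)]
    field_simp
    ring
  have hpos : 0 ≤ c * (∫ x in K, (gradNorm h (fun x ↦ c⁻¹ * w x) x + c⁻¹ * w x * gradNorm h u x)
      ∂riemannianMeasure h -
      ∫ x in K, (gradNorm h u x + u x * gradNorm h u x) ∂riemannianMeasure h) :=
    mul_nonneg hc0.le (by linarith)
  linarith

end Strict

/-! ### The topological conclusion: no compact components -/

section Topology

variable (h : ContMDiffRiemannianMetric (𝓡 3) ∞ E3 (TangentSpace (𝓡 3) : X → Type _))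
  [T2Space X] [LocallyCompactSpace X] [MeasurableSpace X] [BorelSpace X]
  [SecondCountableTopology X] [ConnectedSpace X] [NoncompactSpace X]

/-- **No compact components ⟹ `{v > u}` is empty.** Let `U, v` be locally Lipschitz on the open
set `Ω`, let `W = {x ∈ Ω | U x < v x}` be contained in a compact subset of `Ω`, and suppose
`|∇U| = |∇v| = 0` a.e. on `W`. If `X` is connected and noncompact, then `W = ∅`: on a connected
component `D` of the open set `W` both functions are constant (`a < b`); `D` is open, and not
closed (else `D = X` would be compact), so some boundary point `q ∉ D` has `U q = a < b = v q` by
continuity, whence `q ∈ W` lies in the component `D` after all. This is the last step of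
Huisken–Ilmanen's proof of Thm. 2.2 (i): "`u` and `v` are constant on each component of `{v > u}`.
Since `{v > u}` is precompact in `Ω` and `Ω` has no compact component, … `v ≤ u`."
[cite: HuiskenIlmanenIMCF2001, proof of Thm. 2.2 (i)] -/
theorem eq_empty_of_ae_gradNorm_eq_zero {U v : X → ℝ} {Ω C : Set X} (hΩ : IsOpen Ω)
    (hUl : IsLocLipschitzOn h U Ω) (hvl : IsLocLipschitzOn h v Ω) (hC : IsCompact C) (hCΩ : C ⊆ Ω)
    (hUv : {x | x ∈ Ω ∧ U x < v x} ⊆ C)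
    (hU0 : ∀ᵐ x ∂riemannianMeasure h, x ∈ Ω → U x < v x → gradNorm h U x = 0)
    (hv0 : ∀ᵐ x ∂riemannianMeasure h, x ∈ Ω → U x < v x → gradNorm h v x = 0) :
    {x | x ∈ Ω ∧ U x < v x} = ∅ := by
  haveI : LocallyConnectedSpace X := ChartedSpace.locallyConnectedSpace E3 X
  set W := {x | x ∈ Ω ∧ U x < v x} with hW
  have hUc : ContinuousOn U Ω := hUl.continuousOn h
  have hvc : ContinuousOn v Ω := hvl.continuousOn h
  have hWo : IsOpen W := by
    rw [hW, setOf_and]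
    exact isOpen_iff_mem_nhds.2 fun x hx ↦ inter_mem (hΩ.mem_nhds hx.1)
      (((hUc.continuousAt (hΩ.mem_nhds hx.1)).eventually_lt
        (hvc.continuousAt (hΩ.mem_nhds hx.1)) hx.2).mono fun y hy ↦ hy)
  have hWΩ : W ⊆ Ω := fun x hx ↦ hx.1
  -- the slopes vanish a.e. on `W`
  have hU0' : ∀ᵐ x ∂riemannianMeasure h, x ∈ W → gradNorm h U x = 0 :=
    hU0.mono fun x hx hxW ↦ hx hxW.1 hxW.2
  have hv0' : ∀ᵐ x ∂riemannianMeasure h, x ∈ W → gradNorm h v x = 0 :=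
    hv0.mono fun x hx hxW ↦ hx hxW.1 hxW.2
  by_contra hne
  obtain ⟨x₀, hx₀⟩ := nonempty_iff_ne_empty.2 hne
  -- the component of `x₀` in `W`
  set D := connectedComponentIn W x₀ with hD
  have hDo : IsOpen D := hWo.connectedComponentIn
  have hDW : D ⊆ W := connectedComponentIn_subset W x₀
  have hx₀D : x₀ ∈ D := mem_connectedComponentIn hx₀
  have hDconst : ∀ {f : X → ℝ}, IsLocLipschitzOn h f Ω →
      (∀ᵐ x ∂riemannianMeasure h, x ∈ W → gradNorm h f x = 0) → ∀ y ∈ D, f y = f x₀ :=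
    fun hf hf0 y hy ↦ (hf.mono h hWΩ).eq_of_isPreconnected_of_ae_gradNorm_eq_zero h hWo hf0
      isPreconnected_connectedComponentIn hDW hy hx₀D
  -- `D` is not closed (else it would be all of the noncompact `X`, yet `D ⊆ C`)
  have hDnc : ¬ IsClosed D := by
    intro hDc
    have hDuniv : D = univ := IsClopen.eq_univ ⟨hDc, hDo⟩ ⟨x₀, hx₀D⟩
    have : IsCompact (univ : Set X) :=
      hC.of_isClosed_subset isClosed_univ (hDuniv ▸ hDW.trans hUv)
    exact noncompact_univ X this
  -- a boundary point `q` of `D`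
  obtain ⟨q, hqcl, hqD⟩ : ∃ q, q ∈ closure D ∧ q ∉ D := by
    by_contra hcon
    push Not at hcon
    exact hDnc (closure_subset_iff_isClosed.1 hcon)
  have hqC : q ∈ C := hC.isClosed.closure_subset_iff.2 (hDW.trans hUv) hqcl
  have hqΩ : q ∈ Ω := hCΩ hqC
  -- `U q = U x₀` and `v q = v x₀` by continuity
  have hlim : ∀ {f : X → ℝ}, ContinuousOn f Ω → (∀ y ∈ D, f y = f x₀) → f q = f x₀ := by
    intro f hf hfD
    have h1 : f q ∈ closure (f '' D) :=
      ((hf.continuousAt (hΩ.mem_nhds hqΩ)).continuousWithinAt).mem_closure_image hqcl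
    have h2 : f '' D ⊆ {f x₀} := by rintro _ ⟨y, hy, rfl⟩; exact hfD y hy
    have h3 := closure_mono h2 h1
    rwa [closure_singleton, mem_singleton_iff] at h3
  have hUq : U q = U x₀ := hlim hUc (hDconst hUl hU0')
  have hvq : v q = v x₀ := hlim hvc (hDconst hvl hv0')
  have hqW : q ∈ W := ⟨hqΩ, by rw [hUq, hvq]; exact hx₀.2⟩
  -- hence `q ∈ D`, a contradiction
  obtain ⟨y, hyD', hyD⟩ : (connectedComponentIn W q ∩ D).Nonempty :=
    mem_closure_iff_nhds.1 hqcl _ (hWo.connectedComponentIn.mem_nhds (mem_connectedComponentIn hqW))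
  have h1 : connectedComponentIn W x₀ = connectedComponentIn W y := connectedComponentIn_eq hyD
  have h2 : connectedComponentIn W q = connectedComponentIn W y := connectedComponentIn_eq hyD'
  exact hqD (by rw [hD, h1, ← h2]; exact mem_connectedComponentIn hqW)

end Topology

/-! ### Theorem 2.2 (i) -/

section Uniqueness

variable (h : ContMDiffRiemannianMetric (𝓡 3) ∞ E3 (TangentSpace (𝓡 3) : X → Type _))
  [T2Space X] [LocallyCompactSpace X] [MeasurableSpace X] [BorelSpace X]
  [SecondCountableTopology X] [ConnectedSpace X] [NoncompactSpace X]

/-- **Theorem 2.2 (i) for a nonnegative supersolution.** Let `u ≥ 0` be a weak supersolution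
and `v` a weak subsolution of (∗∗) on the open set `Ω` of the connected noncompact `X`, with
`{v > u} ∩ Ω` contained in a compact `C ⊆ Ω`. Then `v ≤ u` on `Ω`. For `c ∈ (1, 2]`, `U = c u` is a
strict supersolution (`strict_const_mul`) with `{v > U} ⊆ {v > u}`; shifting `v` down by a
constant one arranges `0 < sup (v - U) ≤ ε = 1 - c⁻¹` unless already `v ≤ U`, and then the gap
estimate (`ae_gradNorm_eq_zero_of_strictSupersolution`) and the topological lemma
(`eq_empty_of_ae_gradNorm_eq_zero`) show `{v > U} = ∅`, contradicting positivity of the supremum.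
Hence `v ≤ c u` for all `c > 1`, and `v ≤ u`. Huisken–Ilmanen 2001, proof of Thm. 2.2 (i).
[cite: HuiskenIlmanenIMCF2001, Thm. 2.2 (i)] -/
theorem IsWeakSupersolution.le_of_isWeakSubsolution_of_nonneg {u v : X → ℝ} {Ω C : Set X}
    (hu : IsWeakSupersolution h u Ω) (hv : IsWeakSubsolution h v Ω) (hΩ : IsOpen Ω)
    (hu0 : ∀ x ∈ Ω, 0 ≤ u x) (hC : IsCompact C) (hCΩ : C ⊆ Ω)
    (huv : {x | x ∈ Ω ∧ u x < v x} ⊆ C) : ∀ x ∈ Ω, v x ≤ u x := by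
  have hul := hu.1
  have hvl := hv.1
  -- Step 1: `v ≤ c u` for every `c ∈ (1, 2]`
  have hstep : ∀ c : ℝ, 1 < c → c ≤ 2 → ∀ x ∈ Ω, v x ≤ c * u x := by
    intro c hc1 hc2
    set ε := 1 - c⁻¹ with hε
    have hc0 : 0 < c := by linarith
    have hε0 : 0 < ε := by
      rw [hε, sub_pos, inv_lt_one_iff₀]; exact Or.inr hc1
    have hε1 : ε ≤ 1 := by rw [hε]; linarith [inv_pos.2 hc0]
    have hUl : IsLocLipschitzOn h (fun x ↦ c * u x) Ω := hul.const_mul h c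
    have hstrict := hu.strict_const_mul h hΩ hc1.le
    have hUv : {x | x ∈ Ω ∧ c * u x < v x} ⊆ C := fun x hx ↦
      huv ⟨hx.1, lt_of_le_of_lt (by nlinarith [hu0 x hx.1]) hx.2⟩
    by_contra hcon
    push Not at hcon
    obtain ⟨x₁, hx₁Ω, hx₁⟩ := hcon
    -- the maximum `M > 0` of `v - c u` on `C`
    have hCne : C.Nonempty := ⟨x₁, hUv ⟨hx₁Ω, hx₁⟩⟩
    have hcont : ContinuousOn (fun x ↦ v x - c * u x) C := ((hvl.sub h hUl).continuousOn h).mono hCΩ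
    obtain ⟨x₂, hx₂C, hmax⟩ := hC.exists_isMaxOn hCne hcont
    set M := v x₂ - c * u x₂ with hM
    have hMpos : 0 < M := lt_of_lt_of_le (sub_pos.2 hx₁) (hmax (hUv ⟨hx₁Ω, hx₁⟩))
    -- shift `v` down by `σ = M - min M ε`
    set σ := M - min M ε with hσ
    have hσ0 : 0 ≤ σ := sub_nonneg.2 (min_le_left _ _)
    have hv' : IsWeakSubsolution h (fun x ↦ v x + -σ) Ω := hv.add_const h hΩ (-σ)
    have hUv' : {x | x ∈ Ω ∧ c * u x < v x + -σ} ⊆ C := fun x hx ↦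
      hUv ⟨hx.1, by linarith [hx.2]⟩
    have hvε : ∀ x ∈ Ω, v x + -σ ≤ c * u x + ε := by
      intro x hx
      by_cases hxC : x ∈ C
      · have := hmax hxC
        simp only [mem_setOf_eq] at this
        linarith [min_le_right M ε]
      · have : ¬ (c * u x < v x) := fun hlt ↦ hxC (hUv ⟨hx, hlt⟩)
        linarith [not_lt.1 this]
    obtain ⟨hU0, hv0⟩ := ae_gradNorm_eq_zero_of_strictSupersolution h hΩ hε0 hε1 hUl hstrict hv'
      hC hCΩ hUv' hvε
    have hempty := eq_empty_of_ae_gradNorm_eq_zero h hΩ hUl hv'.1 hC hCΩ hUv' hU0 hv0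
    -- but `x₂` belongs to the set
    have hx₂ : x₂ ∈ {x | x ∈ Ω ∧ c * u x < v x + -σ} := by
      refine ⟨hCΩ hx₂C, ?_⟩
      have : min M ε > 0 := lt_min hMpos hε0
      linarith
    rw [hempty] at hx₂
    exact hx₂
  -- Step 2: let `c → 1`
  intro x hx
  have hT : Tendsto (fun c : ℝ ↦ c * u x) (𝓝[>] 1) (𝓝 (1 * u x)) :=
    ((continuous_id.mul continuous_const).tendsto 1).mono_left nhdsWithin_le_nhds
  rw [one_mul] at hT
  refine ge_of_tendsto hT ?_
  filter_upwards [Ioc_mem_nhdsGT (show (1 : ℝ) < 2 by norm_num)] with c hc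
  exact hstep c hc.1 hc.2 x hx

/-- **Huisken–Ilmanen's Uniqueness Theorem 2.2 (i).** Let `X` be connected and noncompact
("`M` has no compact component"), `Ω ⊆ X` open, `u` a weak supersolution and `v` a weak
subsolution of (∗∗) on `Ω` (in particular, two weak solutions), and suppose `{v > u} ∩ Ω` is
contained in a compact subset of `Ω` (`{v > u} ⊂⊂ Ω`). Then `v ≤ u` on `Ω`. (Reduction to
`le_of_isWeakSubsolution_of_nonneg`: shrink `Ω` to a precompact neighbourhood of the compact set
and add a constant to `u` and `v`, which preserves (1.5) — "we may assume that `u > 0`".)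
Huisken–Ilmanen 2001, Thm. 2.2 (i). [cite: HuiskenIlmanenIMCF2001, Thm. 2.2 (i)] -/
theorem IsWeakSupersolution.le_of_isWeakSubsolution {u v : X → ℝ} {Ω C : Set X}
    (hu : IsWeakSupersolution h u Ω) (hv : IsWeakSubsolution h v Ω) (hΩ : IsOpen Ω)
    (hC : IsCompact C) (hCΩ : C ⊆ Ω) (huv : {x | x ∈ Ω ∧ u x < v x} ⊆ C) :
    ∀ x ∈ Ω, v x ≤ u x := by
  -- a precompact open neighbourhood `Ω₁` of `C` inside `Ω`
  obtain ⟨Ω₁, hΩ₁o, hCΩ₁, hclΩ₁, hcpt⟩ := exists_open_between_and_isCompact_closure hC hΩ hCΩ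
  -- `u` is bounded below on `Ω₁`
  have huc : ContinuousOn u (closure Ω₁) := (hu.1.continuousOn h).mono hclΩ₁
  obtain ⟨M, hM⟩ : ∃ M : ℝ, ∀ x ∈ closure Ω₁, -M ≤ u x := by
    obtain ⟨b, hb⟩ := hcpt.bddBelow_image huc
    exact ⟨-b, fun x hx ↦ by have := hb (mem_image_of_mem u hx); linarith⟩
  -- shifted functions on `Ω₁`
  have hu' : IsWeakSupersolution h (fun x ↦ u x + M) Ω₁ :=
    (hu.mono h hΩ₁o (subset_closure.trans hclΩ₁)).add_const h hΩ₁o M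
  have hv' : IsWeakSubsolution h (fun x ↦ v x + M) Ω₁ :=
    (hv.mono h hΩ₁o (subset_closure.trans hclΩ₁)).add_const h hΩ₁o M
  have hu0 : ∀ x ∈ Ω₁, 0 ≤ u x + M := fun x hx ↦ by linarith [hM x (subset_closure hx)]
  have huv' : {x | x ∈ Ω₁ ∧ u x + M < v x + M} ⊆ C := fun x hx ↦
    huv ⟨(subset_closure.trans hclΩ₁) hx.1, by linarith [hx.2]⟩
  have key := hu'.le_of_isWeakSubsolution_of_nonneg h hv' hΩ₁o hu0 hC hCΩ₁ huv'
  intro x hx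
  by_cases hxC : x ∈ C
  · have := key x (hCΩ₁ hxC); linarith
  · exact not_lt.1 fun hlt ↦ hxC (huv ⟨hx, hlt⟩)

end Uniqueness

/-! ### Theorem 2.2 (ii)–(iii) and the uniqueness clause of Theorem 3.1 -/

section IVP

variable (h : ContMDiffRiemannianMetric (𝓡 3) ∞ E3 (TangentSpace (𝓡 3) : X → Type _))
  [T2Space X] [LocallyCompactSpace X] [MeasurableSpace X] [BorelSpace X]
  [SecondCountableTopology X] [ConnectedSpace X] [NoncompactSpace X]

/-- **Theorem 2.2 (ii): nested initial conditions evolve nested.** Let `u` solve (††) with initial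
condition `E₀` and let `w` be a weak subsolution of (††) with initial condition `F₀ ⊇ E₀`, on a
connected noncompact `X`. If `E_t = {u < t}` is precompact (`t > 0`) then `E_t ⊆ F_t = {w < t}`.
Proof as printed: by (1.18) `w_t = min(w, t)` is a subsolution on `M ∖ F̄₀`; on the precompact open
set `W = E_t ∖ F̄₀`, for each `δ > 0` the supersolution `u + δ` exceeds `w_t` near `∂W` (on `∂E_t`
because `u = t ≥ w_t`, on `∂F₀` because `w = 0 ≤ u`), so `{w_t > u + δ} ⊂⊂ W` and part (i) gives
`w_t ≤ u + δ` on `W`; let `δ → 0`. Huisken–Ilmanen 2001, Thm. 2.2 (ii) and its proof.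
[cite: HuiskenIlmanenIMCF2001, Thm. 2.2 (ii)] -/
theorem IsWeakSolutionIVP.setOf_lt_subset_setOf_lt {u w : X → ℝ} {E₀ F₀ : Set X}
    (hu : IsWeakSolutionIVP h u E₀) (hw : IsWeakSubsolutionIVP h w F₀) (hEF : E₀ ⊆ F₀)
    {t : ℝ} (ht : 0 < t) (hEt : IsCompact (closure {x | u x < t})) :
    {x | u x < t} ⊆ {x | w x < t} := by
  have huc : Continuous u := hu.continuous h
  have hwc : Continuous w := hw.continuous h
  have hF₀ : IsOpen F₀ := hw.isOpen h
  -- the open set `W = E_t ∖ F̄₀` and the functions compared on it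
  set W := {x | u x < t} ∩ (closure F₀)ᶜ with hW
  have hWo : IsOpen W := (isOpen_lt huc continuous_const).inter isClosed_closure.isOpen_compl
  have hWE : W ⊆ (closure E₀)ᶜ := fun x hx hxE ↦ hx.2 (closure_mono hEF hxE)
  have hsub : IsWeakSubsolution h (fun x ↦ min (w x) t) W :=
    (hw.inf_const h t).mono h hWo inter_subset_right
  -- `min(w, t) ≤ u + δ` on `W` for every `δ > 0`
  have hδ : ∀ δ : ℝ, 0 < δ → ∀ x ∈ W, min (w x) t ≤ u x + δ := by
    intro δ hδ
    have hsup : IsWeakSupersolution h (fun x ↦ u x + δ) W :=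
      ((hu.2.2.mono h hWo hWE).isWeakSupersolution h).add_const h hWo δ
    -- the compact set `C = W̄ ∩ {u + δ ≤ min(w, t)}` lies inside `W`
    set C := closure W ∩ {x | u x + δ ≤ min (w x) t} with hC
    have hCc : IsCompact C := by
      refine (hEt.of_isClosed_subset isClosed_closure (closure_mono inter_subset_left)).inter_right ?_
      exact isClosed_le (huc.add continuous_const) (hwc.min continuous_const)
    have hCW : C ⊆ W := by
      rintro x ⟨hxcl, hxle⟩
      have hxle' : u x + δ ≤ min (w x) t := hxle
      refine ⟨?_, fun hxF ↦ ?_⟩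
      · show u x < t
        linarith [min_le_right (w x) t]
      · -- `x ∈ F̄₀`: `x ∉ F₀` (as `W̄ ⊆ F₀ᶜ`), so `x ∈ ∂F₀`, where `w = 0 ≤ u`
        have hxF₀ : x ∉ F₀ := by
          have h1 : closure W ⊆ F₀ᶜ := by
            refine (closure_mono (inter_subset_right.trans (compl_subset_compl.2 subset_closure))).trans ?_
            rw [hF₀.isClosed_compl.closure_eq]
          exact h1 hxcl
        have hxfr : x ∈ frontier F₀ := ⟨hxF, by rwa [hF₀.interior_eq]⟩
        have hw0 : w x = 0 := hw.eq_zero_of_mem_frontier h hxfr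
        have hu0 : 0 ≤ u x := hu.nonneg_of_not_mem h fun hxE ↦ hxF₀ (hEF hxE)
        have : min (w x) t = 0 := by rw [hw0, min_eq_left ht.le]
        linarith
    have hlt : {x | x ∈ W ∧ u x + δ < min (w x) t} ⊆ C := fun x hx ↦
      ⟨subset_closure hx.1, le_of_lt hx.2⟩
    exact hsup.le_of_isWeakSubsolution h hsub hWo hCc hCW hlt
  have hle : ∀ x ∈ W, min (w x) t ≤ u x := fun x hx ↦
    le_of_forall_pos_lt_add fun δ hδ' ↦ by linarith [hδ (δ / 2) (by positivity) x hx]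
  -- conclusion
  intro x hx
  have hx' : u x < t := hx
  by_cases hxF : x ∈ closure F₀
  · rw [closure_eq_self_union_frontier] at hxF
    rcases hxF with hxF | hxF
    · rw [hw.2.1] at hxF
      exact lt_trans hxF ht
    · show w x < t
      rw [hw.eq_zero_of_mem_frontier h hxF]
      exact ht
  · have h1 := hle x ⟨hx', hxF⟩
    show w x < t
    by_contra hge
    rw [min_eq_right (not_lt.1 hge)] at h1
    linarith

/-- **Theorem 2.2 (iii): the sublevel sets of two proper solutions with the same initial condition
coincide.** For proper solutions `u, u'` of (††) with the same precompact initial condition `E₀`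
on a connected noncompact `X`, `{u < t} = {u' < t}` for every `t > 0` (each is a subsolution with
initial condition `E₀ ⊆ E₀`, and both `E_t` are precompact). Huisken–Ilmanen 2001, Thm. 2.2 (iii).
[cite: HuiskenIlmanenIMCF2001, Thm. 2.2 (iii)] -/
theorem IsWeakSolutionIVP.setOf_lt_eq_setOf_lt {u u' : X → ℝ} {E₀ : Set X}
    (hu : IsWeakSolutionIVP h u E₀) (hu' : IsWeakSolutionIVP h u' E₀) (hp : IsProperFun u)
    (hp' : IsProperFun u') (hE₀ : IsCompact (closure E₀)) {t : ℝ} (ht : 0 < t) :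
    {x | u x < t} = {x | u' x < t} :=
  Subset.antisymm
    (hu.setOf_lt_subset_setOf_lt h ⟨hu'.1, hu'.2.1, hu'.2.2.isWeakSubsolution h⟩ Subset.rfl ht
      (hu.isCompact_closure_setOf_lt h hp hE₀ t))
    (hu'.setOf_lt_subset_setOf_lt h ⟨hu.1, hu.2.1, hu.2.2.isWeakSubsolution h⟩ Subset.rfl ht
      (hu'.isCompact_closure_setOf_lt h hp' hE₀ t))

/-- **Uniqueness of proper solutions of (††) off the initial condition.** Two proper solutions of
(††) with the same precompact initial condition `E₀`, on a connected noncompact `X`, agree on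
`X ∖ E₀`. Huisken–Ilmanen 2001, Thm. 2.2 (iii) and the last paragraph of the proof of Thm. 3.1
("Theorem 2.2(iii) implies that `u` is unique"). [cite: HuiskenIlmanenIMCF2001, Thm. 2.2 (iii) and proof of Thm. 3.1] -/
theorem IsWeakSolutionIVP.eq_of_isProperFun {u u' : X → ℝ} {E₀ : Set X}
    (hu : IsWeakSolutionIVP h u E₀) (hu' : IsWeakSolutionIVP h u' E₀) (hp : IsProperFun u)
    (hp' : IsProperFun u') (hE₀ : IsCompact (closure E₀)) : ∀ x ∉ E₀, u' x = u x :=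
  hu.eq_of_setOf_lt_eq h hu' fun _ ht ↦ hu.setOf_lt_eq_setOf_lt h hu' hp hp' hE₀ ht

end IVP

/-- **The uniqueness half of the Weak Existence Theorem 3.1.** In the setting of the named fact
`weak_existence` (`InverseMeanCurvatureFlow.lean`; Huisken–Ilmanen 2001, Thm. 3.1: "there exists a
proper, locally Lipschitz solution `u` of (††) with initial condition `E₀`, *which is unique on
`M ∖ E₀`*"), proper solutions of (††) with a precompact initial condition are unique off `E₀` —
with no completeness, subsolution-at-infinity or smoothness-of-`∂E₀` hypotheses, exactly as in the
source, where uniqueness is Thm. 2.2 (iii). This theorem is the `∀ u'` clause of `weak_existence`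
for any solution `u`; the existence clause (elliptic regularisation, §3) is not proved here.
[cite: HuiskenIlmanenIMCF2001, Thm. 3.1 (uniqueness clause) and Thm. 2.2 (iii)] -/
theorem weak_uniqueness :
    ∀ (X : Type) [TopologicalSpace X] [ChartedSpace E3 X] [IsManifold (𝓡 3) ∞ X] [T2Space X]
      [SecondCountableTopology X] [LocallyCompactSpace X] [ConnectedSpace X] [NoncompactSpace X]
      [MeasurableSpace X] [BorelSpace X]
      (h : ContMDiffRiemannianMetric (𝓡 3) ∞ E3 (TangentSpace (𝓡 3) : X → Type _)),
      ∀ E₀ : Set X, IsCompact (closure E₀) →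
        ∀ u : X → ℝ, IsProperFun u → IsWeakSolutionIVP h u E₀ →
          ∀ u' : X → ℝ, IsProperFun u' → IsWeakSolutionIVP h u' E₀ → ∀ x ∉ E₀, u' x = u x :=
  fun _ _ _ _ _ _ _ _ _ _ _ h _ hE₀ _ hp hu _ hp' hu' ↦ hu.eq_of_isProperFun h hu' hp hp' hE₀

end Literature.Geometry.Lorentzian

end
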